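import Literature.MathematicalPhysics.QuantumLattice.HubbardEffectiveActionCT
import Literature.MathematicalPhysics.QuantumLattice.GrassmannRelabelling
import Literature.MathematicalPhysics.QuantumLattice.FockRelabel
import HarnessLib

/-!
# The point group `D₄` of the square lattice is a symmetry of the countertermed Hubbard
# effective action (no pair seed)

Topic `MathematicalPhysics/QuantumLattice`; companion of `HubbardEffectiveActionCT.lean`
(`hubbardEffectiveActionCT L M β U μ h K Λ = effAction ℂ C^K_{>Λ} V_K`) and `GrassmannRelabelling.lean`
(equivariance of `effAction` and of the kernels under a relabelling of the generators).  The point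
group `D₄ ≅ C₄ᵥ` of the square lattice acts on the dual torus `(ℤ/Lℤ)²` by the tree's `d4Site`
(`PairCorrelations.lean`; bundled permutation `d4SitePerm`, `FockRelabel.lean`), hence on the field
labels `((ω, k⃗), σ, c)` of the Hubbard Grassmann algebra through the spatial momentum only — the
permutation written here, WITHOUT a new definition, as
`Equiv.prodCongr (Equiv.prodCongr (Equiv.prodCongr (Equiv.refl _) (d4SitePerm γ)) (Equiv.refl _)) (Equiv.refl _)`
(local notation `𝔡[L, M, γ]`; the induced algebra map `ψ̂^c_{(ω,k⃗),σ} ↦ ψ̂^c_{(ω,γk⃗),σ}` is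
`ExteriorAlgebra.map (LinearMap.funLeft ℂ ℂ (𝔡[L, M, γ]).symm)`, local notation `ρ[L, M, γ]`).

## Main statements (all proved; no definitions)

* `d4Site_neg`, `d4Site_invariant_of_rot_refl`; `torusBand_d4Site`,
  `TrigPolyC4v.eval_latticeMomentum_d4Site`, **`nambuXiCT_d4Site`** — the band `ε_L`, every frame `K`
  (an even `C₄ᵥ`-invariant trigonometric polynomial read at the lattice momenta) and the renormalised
  band `e_K = ε_L - μ - K` are `D₄`-invariant on the dual torus; hence so is the cutoff weight
  (`hubbardCutoffWeightCT_d4Site`);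
* `hubbardCovarianceCT_d4Field`, **`hubbardCovAboveCT_d4Field`** — at seed `h = 0` the CT covariance
  and its part above scale `Λ` are invariant under the simultaneous relabelling of both arguments
  (`toNambu_d4Field`: the Nambu relabelling commutes with `D₄` because `γ(-k⃗) = -γk⃗`);
* `map_d4Field_hubbardInteraction`, `map_d4Field_counterQuadratic`, **`map_d4Field_hubbardInteractionCT`**
  — the Hubbard vertex (momentum conservation is preserved: `γ` is additive and injective on
  `(ℤ/Lℤ)²`) and the counterterm vertex are invariant;
* **`map_d4Field_hubbardEffectiveActionCT`** — `𝒢^K_Λ ∘ 𝔡⁻¹ = 𝒢^K_Λ` at `h = 0`, and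
  **`kernel_hubbardEffectiveActionCT_d4Field`** — every kernel of `𝒢^K_Λ` is invariant under
  relabelling all its arguments: `F_m(𝔡 X_0, …, 𝔡 X_{m-1}) = F_m(X_0, …, X_{m-1})`.

The seed `h φ_d` (`φ_d` of symmetry `B₁g`) is NOT invariant under the rotation by `π/2`; all
covariance statements are at `h = 0`, which is the case consumed by the symmetric-regime certificate.

## Sources

G. Benfatto, A. Giuliani, V. Mastropietro, Ann. Henri Poincaré 7 (2006) 809, §2.1 (symmetries of
`P(dψ)` and `V`, of which (4) parity `k⃗ ↦ -k⃗` is the element `r²` of `D₄`) [`BenfattoGiulianiMastropietro2006`];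
D. J. Scalapino, Phys. Rep. 250 (1995) 329, §2 (the point group `C₄ᵥ` of the square lattice)
[`Scalapino1995`]; M. Salmhofer, Commun. Math. Phys. 194 (1998) 249, §2.3 (lattice symmetries of the
band) [`Salmhofer1998`].  The statements are routine ("folklore") consequences of these symmetries.
-/

noncomputable section

namespace Literature.MathematicalPhysics.QuantumLattice

open Literature.Probability.LatticeModels GrassmannAlgebra Finset

/-! ### `D₄` on the dual torus: additivity, and invariance of band and frames -/

section Torus

variable {L : ℕ}

/-- `D₄` acts by additive maps, so `γ(-x) = -(γ x)`. [folklore] -/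
theorem d4Site_neg (γ : DihedralGroup 4) (x : TorusSite 2 L) : d4Site γ (-x) = -d4Site γ x :=
  (AddMonoidHom.mk' (d4Site γ) (d4Site_add γ)).map_neg x

/-- A function on the torus that is invariant under the rotation by `π/2` and the axis reflection is
invariant under the whole point group `D₄` (generated by them). [folklore] -/
theorem d4Site_invariant_of_rot_refl {α : Sort*} (f : TorusSite 2 L → α)
    (hrot : ∀ k, f (rotSite k) = f k) (hrefl : ∀ k, f (reflSite k) = f k)
    (γ : DihedralGroup 4) (k : TorusSite 2 L) : f (d4Site γ k) = f k := by
  have hiter : ∀ (n : ℕ) (k : TorusSite 2 L), f (rotSite^[n] k) = f k := by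
    intro n
    induction n with
    | zero => intro k; rfl
    | succ n ih => intro k; rw [Function.iterate_succ_apply', hrot, ih]
  cases γ with
  | r i => exact hiter i.val k
  | sr i =>
    show f (reflSite (rotSite^[i.val] k)) = f k
    rw [hrefl, hiter]

variable [NeZero L]

/-- `cos(m p₁(rot k⃗)) = cos(m p₂(k⃗))` at lattice momenta (`(rot k⃗)₁ = -k⃗₂`). [folklore] -/
theorem cos_nat_mul_latticeMomentum_rotSite_zero (m : ℕ) (k : TorusSite 2 L) :
    Real.cos (m * latticeMomentum L (rotSite k) 0) = Real.cos (m * latticeMomentum L k 1) :=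
  TrigPolyC4v.cos_nat_mul_latticeMomentum_neg m k 1

omit [NeZero L] in
/-- `cos(m p₂(rot k⃗)) = cos(m p₁(k⃗))` (`(rot k⃗)₂ = k⃗₁`). [folklore] -/
theorem cos_nat_mul_latticeMomentum_rotSite_one (m : ℕ) (k : TorusSite 2 L) :
    Real.cos (m * latticeMomentum L (rotSite k) 1) = Real.cos (m * latticeMomentum L k 0) := rfl

omit [NeZero L] in
/-- `cos(m p₁(refl k⃗)) = cos(m p₁(k⃗))` (`(refl k⃗)₁ = k⃗₁`). [folklore] -/
theorem cos_nat_mul_latticeMomentum_reflSite_zero (m : ℕ) (k : TorusSite 2 L) :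
    Real.cos (m * latticeMomentum L (reflSite k) 0) = Real.cos (m * latticeMomentum L k 0) := rfl

/-- `cos(m p₂(refl k⃗)) = cos(m p₂(k⃗))` (`(refl k⃗)₂ = -k⃗₂`). [folklore] -/
theorem cos_nat_mul_latticeMomentum_reflSite_one (m : ℕ) (k : TorusSite 2 L) :
    Real.cos (m * latticeMomentum L (reflSite k) 1) = Real.cos (m * latticeMomentum L k 1) :=
  TrigPolyC4v.cos_nat_mul_latticeMomentum_neg m k 1

/-- The band `ε_L = -2(cos p₁ + cos p₂)` is invariant under the rotation by `π/2`. [folklore] -/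
theorem torusBand_rotSite (k : TorusSite 2 L) : torusBand L (rotSite k) = torusBand L k := by
  have h0 := cos_nat_mul_latticeMomentum_rotSite_zero 1 k
  have h1 := cos_nat_mul_latticeMomentum_rotSite_one 1 k
  simp only [Nat.cast_one, one_mul] at h0 h1
  simp only [torusBand, Fin.sum_univ_two, h0, h1, add_comm]

/-- The band is invariant under the axis reflection. [folklore] -/
theorem torusBand_reflSite (k : TorusSite 2 L) : torusBand L (reflSite k) = torusBand L k := by
  have h0 := cos_nat_mul_latticeMomentum_reflSite_zero 1 k
  have h1 := cos_nat_mul_latticeMomentum_reflSite_one 1 k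
  simp only [Nat.cast_one, one_mul] at h0 h1
  simp only [torusBand, Fin.sum_univ_two, h0, h1]

/-- **The band is `D₄`-invariant on the dual torus** (Salmhofer 1998 §2.3: the lattice symmetries of
`E`). [folklore] -/
theorem torusBand_d4Site (γ : DihedralGroup 4) (k : TorusSite 2 L) : torusBand L (d4Site γ k) = torusBand L k :=
  d4Site_invariant_of_rot_refl _ torusBand_rotSite torusBand_reflSite γ k

/-- The symmetrised harmonics are invariant under the rotation by `π/2` at lattice momenta. [folklore] -/
theorem TrigPolyC4v.harmonic_latticeMomentum_rotSite (m n : ℕ) (k : TorusSite 2 L) :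
    TrigPolyC4v.harmonic m n (latticeMomentum L (rotSite k)) = TrigPolyC4v.harmonic m n (latticeMomentum L k) := by
  rw [TrigPolyC4v.harmonic, TrigPolyC4v.harmonic, cos_nat_mul_latticeMomentum_rotSite_zero,
    cos_nat_mul_latticeMomentum_rotSite_zero, cos_nat_mul_latticeMomentum_rotSite_one,
    cos_nat_mul_latticeMomentum_rotSite_one]
  ring

/-- The symmetrised harmonics are invariant under the axis reflection at lattice momenta. [folklore] -/
theorem TrigPolyC4v.harmonic_latticeMomentum_reflSite (m n : ℕ) (k : TorusSite 2 L) :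
    TrigPolyC4v.harmonic m n (latticeMomentum L (reflSite k)) = TrigPolyC4v.harmonic m n (latticeMomentum L k) := by
  rw [TrigPolyC4v.harmonic, TrigPolyC4v.harmonic, cos_nat_mul_latticeMomentum_reflSite_zero,
    cos_nat_mul_latticeMomentum_reflSite_zero, cos_nat_mul_latticeMomentum_reflSite_one,
    cos_nat_mul_latticeMomentum_reflSite_one]

/-- **Frames are `D₄`-invariant on the dual torus**: `K(p(γk⃗)) = K(p(k⃗))` (the form in which the
`C₄ᵥ`-invariance `eval_rot`/`eval_reflect` is consumed at lattice momenta, where `p(γk⃗)` and `γ p(k⃗)`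
differ by a reciprocal lattice vector). [folklore] -/
theorem TrigPolyC4v.eval_latticeMomentum_d4Site (K : TrigPolyC4v) (γ : DihedralGroup 4) (k : TorusSite 2 L) :
    K.eval (latticeMomentum L (d4Site γ k)) = K.eval (latticeMomentum L k) :=
  d4Site_invariant_of_rot_refl (fun k => K.eval (latticeMomentum L k))
    (fun k => by simp only [TrigPolyC4v.eval, TrigPolyC4v.harmonic_latticeMomentum_rotSite])
    (fun k => by simp only [TrigPolyC4v.eval, TrigPolyC4v.harmonic_latticeMomentum_reflSite]) γ k

/-- **The renormalised band `e_K = ε_L - μ - K` is `D₄`-invariant** on the dual torus. [folklore] -/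
theorem nambuXiCT_d4Site (μ : ℝ) (K : TrigPolyC4v) (γ : DihedralGroup 4) (k : TorusSite 2 L) :
    nambuXiCT L μ K (d4Site γ k) = nambuXiCT L μ K k := by
  rw [nambuXiCT, nambuXiCT, torusBand_d4Site, TrigPolyC4v.eval_latticeMomentum_d4Site]

end Torus

/-! ### `D₄` on the field labels; invariance of the CT covariance at `h = 0` -/

/-- The permutation of the Hubbard field labels `((ω, k⃗), σ, c) ↦ ((ω, γ k⃗), σ, c)` induced by
`γ ∈ D₄` (spatial momentum only). -/
local notation "𝔡[" L ", " M ", " γ "]" =>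
  (Equiv.prodCongr (Equiv.prodCongr (Equiv.prodCongr (Equiv.refl (MatsubaraIdx M)) (d4SitePerm (L := L) γ))
    (Equiv.refl (Fin 2))) (Equiv.refl (Fin 2)))

/-- The induced relabelling `ψ̂^c_{(ω,k⃗),σ} ↦ ψ̂^c_{(ω,γk⃗),σ}` of the Hubbard Grassmann algebra. -/
local notation "ρ[" L ", " M ", " γ "]" =>
  ExteriorAlgebra.map (LinearMap.funLeft ℂ ℂ (Equiv.symm 𝔡[L, M, γ]))

section Fields

variable (L M : ℕ) [NeZero L]

omit [NeZero L] in
/-- The field permutation in coordinates. [folklore] -/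
theorem d4Field_apply (γ : DihedralGroup 4) (X : HubbardFieldIdx L M) :
    𝔡[L, M, γ] X = (((X.1.1.1, d4Site γ X.1.1.2), X.1.2), X.2) := rfl

omit [NeZero L] in
/-- The relabelling on `ψ̂⁺`: `ψ̂⁺_{(ω,k⃗),σ} ↦ ψ̂⁺_{(ω,γk⃗),σ}`. [folklore] -/
theorem map_d4Field_psiPlus (γ : DihedralGroup 4) (ω : MatsubaraIdx M) (p : TorusSite 2 L) (s : Fin 2) :
    ρ[L, M, γ] (psiPlus (ω, p) s) = psiPlus (ω, d4Site γ p) s := by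
  unfold psiPlus
  rw [map_funLeft_gen]
  rfl

omit [NeZero L] in
/-- The relabelling on `ψ̂⁻`: `ψ̂⁻_{(ω,k⃗),σ} ↦ ψ̂⁻_{(ω,γk⃗),σ}`. [folklore] -/
theorem map_d4Field_psiMinus (γ : DihedralGroup 4) (ω : MatsubaraIdx M) (p : TorusSite 2 L) (s : Fin 2) :
    ρ[L, M, γ] (psiMinus (ω, p) s) = psiMinus (ω, d4Site γ p) s := by
  unfold psiMinus
  rw [map_funLeft_gen]
  rfl

omit [NeZero L] in
/-- **The Nambu relabelling commutes with `D₄`** (because `γ(-k⃗) = -γk⃗`). [folklore] -/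
theorem toNambu_d4Field (γ : DihedralGroup 4) (X : HubbardFieldIdx L M) :
    toNambu (𝔡[L, M, γ] X) = 𝔡[L, M, γ] (toNambu X) := by
  obtain ⟨⟨⟨ω, p⟩, s⟩, c⟩ := X
  by_cases hs : s = 0
  · simp [toNambu, hs]
  · simp [toNambu, hs, FreqMomentum.neg, d4Site_neg]

/-- The CT cutoff weight is `D₄`-invariant (it reads `e_K`). [folklore] -/
theorem hubbardCutoffWeightCT_d4Site (γ : DihedralGroup 4) (β μ : ℝ) (K : TrigPolyC4v) (Λ : ℝ) (k : FreqMomentum L M) :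
    hubbardCutoffWeightCT L M β μ K Λ (k.1, d4Site γ k.2) = hubbardCutoffWeightCT L M β μ K Λ k := by
  simp only [hubbardCutoffWeightCT, nambuXiCT_d4Site]

/-- The seedless CT Nambu propagator is `D₄`-invariant. [folklore] -/
theorem nambuPropagatorCT_d4Site (γ : DihedralGroup 4) (β μ : ℝ) (K : TrigPolyC4v) (k : FreqMomentum L M) :
    nambuPropagatorCT L M β μ 0 K (k.1, d4Site γ k.2) = nambuPropagatorCT L M β μ 0 K k := by
  simp only [nambuPropagatorCT, nambuDenCT, nambuXiCT_d4Site, zero_mul]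

/-- The seedless CT Nambu two-point table is invariant under relabelling both arguments. [folklore] -/
theorem nambuTwoPointCT_d4Field (γ : DihedralGroup 4) (β μ : ℝ) (K : TrigPolyC4v) (X Y : HubbardFieldIdx L M) :
    nambuTwoPointCT L M β μ 0 K (𝔡[L, M, γ] X) (𝔡[L, M, γ] Y) = nambuTwoPointCT L M β μ 0 K X Y := by
  simp only [nambuTwoPointCT, d4Field_apply, nambuPropagatorCT_d4Site, Prod.ext_iff,
    (d4Site_injective γ).eq_iff]

/-- **The seedless CT covariance is `D₄`-invariant**: `C^K(𝔡X, 𝔡Y) = C^K(X, Y)` at `h = 0`. [folklore] -/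
theorem hubbardCovarianceCT_d4Field (γ : DihedralGroup 4) (β μ : ℝ) (K : TrigPolyC4v) (X Y : HubbardFieldIdx L M) :
    hubbardCovarianceCT L M β μ 0 K (𝔡[L, M, γ] X) (𝔡[L, M, γ] Y) = hubbardCovarianceCT L M β μ 0 K X Y := by
  simp only [hubbardCovarianceCT, Matrix.of_apply, hubbardTwoPointCT, toNambu_d4Field, nambuTwoPointCT_d4Field]

/-- **The seedless CT covariance above scale `Λ` is `D₄`-invariant**: `C^K_{>Λ}(𝔡X, 𝔡Y) = C^K_{>Λ}(X, Y)`
(the symmetry of the Gaussian integration, BGM 2006 §2.1, for the point group). [folklore] -/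
theorem hubbardCovAboveCT_d4Field (γ : DihedralGroup 4) (β μ : ℝ) (K : TrigPolyC4v) (Λ : ℝ)
    (X Y : HubbardFieldIdx L M) :
    hubbardCovAboveCT L M β μ 0 K Λ (𝔡[L, M, γ] X) (𝔡[L, M, γ] Y) = hubbardCovAboveCT L M β μ 0 K Λ X Y := by
  simp only [hubbardCovAboveCT, Matrix.of_apply, hubbardCovarianceCT_d4Field]
  simp only [momentumOf, d4Field_apply, hubbardCutoffWeightCT_d4Site]

/-! ### Invariance of the interaction slot and of the effective action -/

/-- **The Hubbard vertex is `D₄`-invariant**: `V ∘ 𝔡⁻¹ = V` (momentum conservation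
`k⃗₁ + k⃗₃ = k⃗₂ + k⃗₄` is preserved since `γ` is additive and injective; BGM 2006 §2.1). [folklore] -/
theorem map_d4Field_hubbardInteraction (γ : DihedralGroup 4) (β U : ℝ) :
    ρ[L, M, γ] (hubbardInteraction L M β U) = hubbardInteraction L M β U := by
  rw [hubbardInteraction, map_smul]
  congr 1
  rw [map_sum]
  refine Fintype.sum_equiv (Equiv.prodCongr (Equiv.refl (MatsubaraIdx M)) (d4SitePerm (L := L) γ)) _ _
    fun k₁ => ?_
  obtain ⟨ω₁, p₁⟩ := k₁
  rw [map_sum]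
  refine Fintype.sum_equiv (Equiv.prodCongr (Equiv.refl (MatsubaraIdx M)) (d4SitePerm (L := L) γ)) _ _
    fun k₂ => ?_
  obtain ⟨ω₂, p₂⟩ := k₂
  rw [map_sum]
  refine Fintype.sum_equiv (Equiv.prodCongr (Equiv.refl (MatsubaraIdx M)) (d4SitePerm (L := L) γ)) _ _
    fun k₃ => ?_
  obtain ⟨ω₃, p₃⟩ := k₃
  rw [map_sum]
  refine Fintype.sum_equiv (Equiv.prodCongr (Equiv.refl (MatsubaraIdx M)) (d4SitePerm (L := L) γ)) _ _
    fun k₄ => ?_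
  obtain ⟨ω₄, p₄⟩ := k₄
  simp only [Equiv.prodCongr_apply, Prod.map_apply, Equiv.refl_apply, d4SitePerm_apply, ← d4Site_add,
    (d4Site_injective γ).eq_iff]
  split_ifs
  · simp only [map_mul, map_d4Field_psiPlus, map_d4Field_psiMinus]
  · exact map_zero _

/-- **The counterterm vertex is `D₄`-invariant**: `𝒩_K ∘ 𝔡⁻¹ = 𝒩_K` (the frame is). [folklore] -/
theorem map_d4Field_counterQuadratic (γ : DihedralGroup 4) (β : ℝ) (K : TrigPolyC4v) :
    ρ[L, M, γ] (counterQuadratic L M β K) = counterQuadratic L M β K := by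
  rw [counterQuadratic, map_sum]
  refine Fintype.sum_equiv (Equiv.prodCongr (Equiv.refl (MatsubaraIdx M)) (d4SitePerm (L := L) γ)) _ _
    fun k => ?_
  obtain ⟨ω, p⟩ := k
  simp only [map_sum, map_smul, map_mul, map_d4Field_psiPlus, map_d4Field_psiMinus, Equiv.prodCongr_apply,
    Prod.map_apply, Equiv.refl_apply, d4SitePerm_apply, TrigPolyC4v.eval_latticeMomentum_d4Site]

/-- **The interaction slot `V_K = V + 𝒩_K` is `D₄`-invariant.** [folklore] -/
theorem map_d4Field_hubbardInteractionCT (γ : DihedralGroup 4) (β U : ℝ) (K : TrigPolyC4v) :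
    ρ[L, M, γ] (hubbardInteractionCT L M β U K) = hubbardInteractionCT L M β U K := by
  rw [hubbardInteractionCT, map_add, map_d4Field_hubbardInteraction, map_d4Field_counterQuadratic]

/-- **`D₄` is a symmetry of the seedless countertermed effective action**: `𝒢^K_Λ ∘ 𝔡⁻¹ = 𝒢^K_Λ` at
`h = 0`, for every `γ ∈ D₄`, frame `K` and scale `Λ` (covariance and interaction are invariant, and
`effAction` is equivariant, `map_funLeft_effAction_of_invariant`). [folklore] -/
theorem map_d4Field_hubbardEffectiveActionCT (γ : DihedralGroup 4) (β U μ : ℝ) (K : TrigPolyC4v) (Λ : ℝ) :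
    ρ[L, M, γ] (hubbardEffectiveActionCT L M β U μ 0 K Λ) = hubbardEffectiveActionCT L M β U μ 0 K Λ :=
  map_funLeft_effAction_of_invariant ℂ _ (hubbardCovAboveCT_d4Field L M γ β μ K Λ)
    (map_d4Field_hubbardInteractionCT L M γ β U K)

/-- The seedless CT partition function of the relabelled interaction is unchanged (recorded for
completeness; here the interaction is itself invariant). [folklore] -/
theorem hubbardEffPartitionFnCT_d4Field (γ : DihedralGroup 4) (β U μ : ℝ) (K : TrigPolyC4v) (Λ : ℝ) :
    effPartitionFn ℂ (hubbardCovAboveCT L M β μ 0 K Λ) (ρ[L, M, γ] (hubbardInteractionCT L M β U K)) =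
      hubbardEffPartitionFnCT L M β U μ 0 K Λ :=
  effPartitionFn_of_invariant ℂ _ (hubbardCovAboveCT_d4Field L M γ β μ K Λ) _

/-- **The kernels of the seedless countertermed effective action are `D₄`-invariant**:
`F_m(𝔡X_0, …, 𝔡X_{m-1}) = F_m(X_0, …, X_{m-1})` for every degree `m` — the form consumed by the
certificate functionals (self-energy, field strength, Cooper amplitude, …). [folklore] -/
theorem kernel_hubbardEffectiveActionCT_d4Field (γ : DihedralGroup 4) (β U μ : ℝ) (K : TrigPolyC4v) (Λ : ℝ)
    (m : ℕ) (X : Fin m → HubbardFieldIdx L M) :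
    kernel ℂ (hubbardEffectiveActionCT L M β U μ 0 K Λ) m (𝔡[L, M, γ] ∘ X) =
      kernel ℂ (hubbardEffectiveActionCT L M β U μ 0 K Λ) m X :=
  kernel_comp_perm_of_invariant ℂ _ (map_d4Field_hubbardEffectiveActionCT L M γ β U μ K Λ) m X

end Fields

end Literature.MathematicalPhysics.QuantumLattice
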